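import Summits.BirchSwinnertonDyer.BirchSwinnertonDyer.Theorems.SmallImageMuTransferMuTransferX9LocalTransverseValue
import Summits.BirchSwinnertonDyer.BirchSwinnertonDyer.Theorems.SmallImageMuTransferMuTransferX9LocalSplitPrime
import HarnessLib

/-!
# K6 crux `MuTransferX9` (stmt-BirchSwinnertonDyer-19276), CORE-PLAN S4.2 (file 5): MU-TRANSFER-PROOF
# §2 LEMMA 1 (i) in TOWER form — lowering the level by the depth kills the transverse part:
# the image of `H¹(K_q, 𝒯_{J'}) → H¹(K_q, 𝒯_J)` is UNRAMIFIED when `J' ≥ J + e_q`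

Cell `bsd-smallim`, seat `bsd-smallim-koly` gen 7 (route `SmallImageMuTransfer`, rung K6, leaf
`Rank1Residual.BSDpOnClassX9`). HONEST FRAMING: TOOL theorems of local Galois cohomology; no definition,
no named fact, no `sorry`; nothing is asserted about any curve and nothing is booked; class X9 stays
TYPED at class level. Serves the OPEN registered stub `stub_coreX9` of crux 19276 (skeleton v4
0154dd5daf38efd6) and credits nothing toward its closure (`--supports … --as helper`).
PARTITION (D-0054): X9 (A4) × p ∈ {5, 7} — helper; closes NONE.

## Content

MU-TRANSFER-PROOF Lemma 1 (i) says that over the `Ω`-adic module `𝒯 = E[p] ⊗ Ω(χ)` every local class at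
an `E`-split `q` is unramified and is its value at `Fr` in `𝒯/(φ̃−1)𝒯 = 𝒯/T^e𝒯` (`φ̃ − 1` is injective on
`𝒯`).  In the tree the `Ω`-adic object is a TOWER of the finite levels `𝒯_J` (k6-c2's `twistTower`,
transitions = k6-ty's `twistModPTruncate`); the finite-level content of Lemma 1 (i) is:
**if `J + p^m ≤ J'` (`p^m = e_q` the depth of `q`), the map `H¹(K_q, 𝒯_{J'}) → H¹(K_q, 𝒯_J)` induced by
ANY equivariant map acting as truncation `x ↦ (x_i)_{i<J}` lands in `H¹_ur(K_q, 𝒯_J)`**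
(`map_mem_unramifiedSubgroup_of_truncate_of_split`): the values of a cocycle of `𝒯_{J'}` on the inertia
group are `Γ_{K_q}`-invariant (file 4 `apply_cocycle_apply_eq_self_of_mem_absInertia`), hence fixed by
the `E`-split Frobenius, hence in `𝒯_{J'}[T^{p^m}] = T^{J'−p^m}𝒯_{J'}` (file 2
`toLocal_twistModP_apply_eq_self_iff_of_split`), whose truncation to level `J ≤ J' − p^m` is `0`; a
cocycle vanishing on inertia is unramified (x9 `mem_unramifiedSubgroup_one_iff_forall_eq_zero`).  So
every element of the local tower `lim_J H¹(K_q, 𝒯_J)` is unramified at each level, i.e. "is" its value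
at `Fr` — the memo's `loc_q 𝐳̄_1 = t_1 mod T^e`, `t_1 = c_1(Fr)` (STEP 3).
Also: `galoisCohomology_map_oneCocycleClass` (the tree's `galoisCohomology.map f 1` on an explicit
cocycle is the class of `f ∘ φ`; bookkeeping for Mathlib's `ContinuousCohomology.map`).

References: HOME/koly/MU-TRANSFER-PROOF.md §2 Lemma 1 (i); B. Mazur, K. Rubin, Mem. AMS 799 (2004)
Lemma 1.2.1, §5.3 [MazurRubin2004]; K. Rubin, PCMI 18 (2011) Prop. 1.9.5 [Rubin2011].
-/

set_option linter.dupNamespace false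
set_option autoImplicit false

noncomputable section

open scoped Classical ContRepresentation

universe u

namespace Summit.BirchSwinnertonDyer.BirchSwinnertonDyer.Rank1Residual.LocalSplitPrime

open CategoryTheory ContinuousCohomology Function Field ValuativeRel NumberField IsDedekindDomain
open Literature.NumberTheory.GaloisRepresentations
open Literature.NumberTheory.GaloisRepresentations.IsNonarchimedeanLocalField
open _root_.TopRep
open Literature.NumberTheory.GaloisCohomology
open Literature.NumberTheory.EllipticCurves
open Summit.BirchSwinnertonDyer.Rank1Residual.GaloisImage
open Summit.BirchSwinnertonDyer.Rank1Residual (X11b.LocBridge.mem_unramifiedSubgroup_one_iff_forall_eq_zero)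

section MapCocycle

variable {F : Type u} [Field F] {M N : Type u} [AddCommGroup M] [TopologicalSpace M] [DiscreteTopology M]
  [AddCommGroup N] [TopologicalSpace N] [DiscreteTopology N]
  (ρ : DiscreteGaloisModule F M) (ρ' : DiscreteGaloisModule F N)

/-- `galoisCohomology.map f 1` on an explicit cocycle: `[φ] ↦ [f ∘ φ]` (Mathlib's
`ContinuousCohomology.map` along the identity of `Γ_F`, `map_oneCocycleClass`). [folklore] -/
theorem galoisCohomology_map_oneCocycleClass
    (f : ρ.toContRepresentation →ⁱL ρ'.toContRepresentation) (φ : contOneCocycles ρ.toTopRep) :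
    ∃ ψ : contOneCocycles ρ'.toTopRep, (∀ g, ψ.1 g = f (φ.1 g)) ∧
      galoisCohomology.map f 1 (oneCocycleClass ρ.toTopRep φ) = oneCocycleClass ρ'.toTopRep ψ := by
  refine ⟨contOneCocycles.pullback (ContinuousMonoidHom.id (absoluteGaloisGroup F))
    (X := ρ.toTopRep) (Y := ρ'.toTopRep) (TopRep.ofHom ⟨f.toContinuousLinearMap, f.isIntertwining'⟩) φ,
    fun g => rfl, ?_⟩
  exact map_oneCocycleClass (ContinuousMonoidHom.id (absoluteGaloisGroup F))
    (X := ρ.toTopRep) (Y := ρ'.toTopRep) (TopRep.ofHom ⟨f.toContinuousLinearMap, f.isIntertwining'⟩) φ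

end MapCocycle

section TowerUnramified

variable {K : Type u} [Field K] [NumberField K] {M : Type u} [AddCommGroup M] [TopologicalSpace M]
  [DiscreteTopology M] [Finite M] (ρ : DiscreteGaloisModule K M) {p : ℕ} [Fact p.Prime]
  (hM : ∀ x : M, p • x = 0) (κ : ZpExtension K p) {J J' : ℕ} (q : HeightOneSpectrum (𝓞 K))

/-- **MU-TRANSFER-PROOF Lemma 1 (i), tower form: lowering the level by the depth kills ramification.**
At a finite place `q ∤ p` with `ρ` unramified at `q`, `N(q) = ℓ` prime, `p ∣ ℓ − 1`, `χ̄_ℓ` onto on the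
inertia of `K_q` (`hχI`), and an `E`-split Frobenius `φ` of depth `m` (`ρ(res φ) = 1`,
`res φ ∈ Gal(K̄/K_m) ∖ Gal(K̄/K_{m+1})`, `m + 1 ≤ J'`): for ANY `Γ_{K_q}`-equivariant continuous map
`f : 𝒯_{J'}|_q → 𝒯_J|_q` acting as the truncation `x ↦ (x_i)_{i < J}` (e.g. the restriction of k6-ty's
`twistModPTruncate`) with `J + p^m ≤ J'`, the induced map `H¹(K_q, 𝒯_{J'}) → H¹(K_q, 𝒯_J)` takes values
in the UNRAMIFIED subgroup.  (Values of a cocycle on inertia are `Γ`-invariant — file 4 — hence fixed by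
`φ`, hence in `𝒯_{J'}[T^{p^m}] = T^{J'−p^m}𝒯_{J'}` — file 2 — whose first `J` coordinates vanish.)
[cite: MazurRubin2004, Lemma 1.2.1] [cite: Rubin2011, Prop. 1.9.5 (2) (p. 16)] -/
theorem map_mem_unramifiedSubgroup_of_truncate_of_split
    [Fact (Ideal.absNorm q.asIdeal).Prime]
    [NeZero ((Ideal.absNorm q.asIdeal : ℕ) : q.adicCompletion K)]
    (hunr : GaloisRep.IsUnramifiedAt q ρ) (hqp : (p : 𝓞 K) ∉ q.asIdeal)
    (hpl : p ∣ Ideal.absNorm q.asIdeal - 1)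
    (hχI : ∀ u : (ZMod (Ideal.absNorm q.asIdeal))ˣ, ∃ t ∈ absInertia (q.adicCompletion K),
      modPCyclotomicCharacterZMod (q.adicCompletion K) (Ideal.absNorm q.asIdeal) t = u)
    {φ : absoluteGaloisGroup (q.adicCompletion K)}
    (hsplit : ρ (absGaloisRestrict K (q.adicCompletion K) φ) = 1) {m : ℕ} (hm : m + 1 ≤ J')
    (hφm : absGaloisRestrict K (q.adicCompletion K) φ ∈ κ.layerSubgroup m)
    (hφm' : absGaloisRestrict K (q.adicCompletion K) φ ∉ κ.layerSubgroup (m + 1))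
    (hJ : J + p ^ m ≤ J')
    (f : (GaloisRep.toLocal q (κ.twistModP ρ hM J')).toContRepresentation →ⁱL
      (GaloisRep.toLocal q (κ.twistModP ρ hM J)).toContRepresentation)
    (hf : ∀ (x : Fin J' → M) (i : Fin J), f x i = x ⟨i, by omega⟩)
    (c : galoisCohomology (GaloisRep.toLocal q (κ.twistModP ρ hM J')) 1) :
    galoisCohomology.map f 1 c ∈
      DiscreteGaloisModule.unramifiedSubgroup (GaloisRep.toLocal q (κ.twistModP ρ hM J)) 1 := by
  set L := q.adicCompletion K
  have hI' : ∀ t ∈ absInertia L, ∀ x : Fin J' → M, GaloisRep.toLocal q (κ.twistModP ρ hM J') t x = x :=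
    fun _ ht x => toLocal_twistModP_apply_of_mem_absInertia ρ hM κ J' q hunr hqp ht x
  have hI : ∀ t ∈ absInertia L, ∀ x : Fin J → M, GaloisRep.toLocal q (κ.twistModP ρ hM J) t x = x :=
    fun _ ht x => toLocal_twistModP_apply_of_mem_absInertia ρ hM κ J q hunr hqp ht x
  obtain ⟨ψ', rfl⟩ := oneCocycleClass_surjective _ c
  obtain ⟨ψ, hψ, hmap⟩ := galoisCohomology_map_oneCocycleClass _ _ f ψ'
  rw [hmap]
  refine (X11b.LocBridge.mem_unramifiedSubgroup_one_iff_forall_eq_zero _ hI ψ).2 fun t ht => ?_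
  rw [hψ]
  -- the value `ψ'(t)` is `Γ_{K_q}`-invariant, hence fixed by the split Frobenius, hence in `ker S^{p^m}`
  have hinv : GaloisRep.toLocal q (κ.twistModP ρ hM J') φ (ψ'.1 t) = ψ'.1 t :=
    apply_cocycle_apply_eq_self_of_mem_absInertia _ (Ideal.absNorm q.asIdeal)
      (ringChar_residueField_adicCompletion_eq q) hI' (sub_one_smul_eq_zero_of_dvd hM hpl) hχI ψ' ht φ
  have hker : (shiftEnd M J' ^ (p ^ m)) (ψ'.1 t) = 0 :=
    (toLocal_twistModP_apply_eq_self_iff_of_split ρ hM κ J' q hsplit hm hφm hφm' (ψ'.1 t)).1 hinv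
  have hcoord := (shiftEnd_pow_apply_eq_zero_iff (p ^ m) (ψ'.1 t)).1 hker
  funext i
  rw [hf, Pi.zero_apply]
  exact hcoord ⟨i, by omega⟩ (by simp only; omega)

end TowerUnramified

end Summit.BirchSwinnertonDyer.BirchSwinnertonDyer.Rank1Residual.LocalSplitPrime

end
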